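import Literature.Probability.RandomPlanarGeometry.SAWStripTMMerge
import HarnessLib

/-!
# Strand families: extending and creating strands (soundness, part 3)

Topic `Literature/Probability/RandomPlanarGeometry` (soundness of `SAWStripTM.lean`, part 3;
continues `SAWStripTMMerge.lean`). The three derived operations used by the enriched transfer
matrix, each a `merge` after adding fresh singleton strands, with their specifications:

* `extend_spec`  : `merge (S ++ [[y]]) x y` — extend the strand ending at the real end `x` by a
  fresh vertex `y` (a grid cell, or a virtual vertex being attached);
* `extend_left_spec` : `merge (S ++ [[x]]) x y` — the same with the fresh vertex `x` in front;
* `new2_spec` : `merge (S ++ [[x]] ++ [[y]]) x y` — a new two-vertex strand.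

## References

* D. E. Knuth, *The Art of Computer Programming*, Vol. 4A (2011), §7.1.4, `SIMPATH`.
-/

namespace Literature.Probability.RandomPlanarGeometry.SAW

namespace StripTM

variable {A : XCell → XCell → Prop}

/-- A strand of length `≥ 2` is not a singleton. [folklore] -/
theorem ne_singleton_of_two_le {π : List XCell} (h : 2 ≤ π.length) (z : XCell) : π ≠ [z] := by
  rintro rfl; simp at h

/-- End pairs have their first component among the cells. [folklore] -/
theorem mem_cells_of_mem_endPairs {S : List (List XCell)} {a b : XCell} (h : (a, b) ∈ endPairs S) :
    a ∈ cells S := by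
  obtain ⟨π, hπ, hp⟩ := mem_endPairs.1 h
  exact mem_cells.2 ⟨π, hπ, mem_of_isEnd (isEnd_of_mem_epairs hp)⟩

/-- **Extend** the strand ending at the real end `x` (of a strand of length `≥ 2`) by the fresh
vertex `y`. [cite: Jensen2004SAWLowerBounds, §2.1] -/
theorem extend_spec {S : List (List XCell)} (hW : WF A S) (hA : ∀ a b, A a b → A b a)
    (h2 : ∀ π ∈ S, 2 ≤ π.length) {x bx y : XCell} (hxb : (x, bx) ∈ endPairs S)
    (hxr : x.IsReal) (hy : y ∉ cells S) (hxy : A x y) :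
      WF A (merge (S ++ [[y]]) x y) ∧ (∀ π' ∈ merge (S ++ [[y]]) x y, 2 ≤ π'.length) ∧
      cells (merge (S ++ [[y]]) x y) = insert y (cells S) ∧
      pairs (merge (S ++ [[y]]) x y) = insert s(x, y) (pairs S) ∧
      ∀ a b, (a, b) ∈ endPairs (merge (S ++ [[y]]) x y) ↔
        ((a, b) ∈ endPairs S ∧ a ≠ x ∧ a ≠ bx) ∨ (a = bx ∧ b = y) ∨ (a = y ∧ b = bx) := by
  obtain ⟨π, hπ, hxπ⟩ := mem_endPairs.1 hxb
  have hx : isEnd x π = true := isEnd_of_mem_epairs hxπ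
  have hW₁ : WF A (S ++ [[y]]) := hW.add_singleton hy
  have hπ₁ : π ∈ S ++ [[y]] := List.mem_append_left _ hπ
  have hy₁ : [y] ∈ S ++ [[y]] := List.mem_append_right _ (List.mem_singleton_self _)
  have hne : π ≠ [y] := ne_singleton_of_two_le (h2 π hπ) y
  have hye : isEnd y [y] = true := by simp [isEnd]
  have hxS : x ∈ cells S := mem_cells.2 ⟨π, hπ, mem_of_isEnd hx⟩
  have hxy' : x ≠ y := fun e => hy (e ▸ hxS)
  obtain ⟨bx', by_, hbx, hby, hWm, hcells, hpairs, hends⟩ :=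
    merge_spec hW₁ hA hπ₁ hy₁ hne hx hye hxy (Or.inl hxr) (Or.inr rfl)
  rw [endPairs_add_singleton, Finset.mem_insert, Prod.mk.injEq] at hbx hby
  have hbx' : (x, bx') ∈ endPairs S := by
    rcases hbx with ⟨e, -⟩ | h; exact absurd e hxy'; exact h
  have hby' : by_ = y := by
    rcases hby with ⟨-, e⟩ | h; exact e; exact absurd (mem_cells_of_mem_endPairs h) hy
  subst hby'
  have hbb : bx' = bx := hW.endPairs_unique hbx' hxb
  subst hbb
  refine ⟨hWm, ?_, ?_, ?_, ?_⟩
  · intro π' hπ'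
    rcases hW₁.mem_merge hπ₁ hy₁ hx hye hπ' with ⟨hm, hn1, hn2⟩ | hlen
    · rw [List.mem_append, List.mem_singleton] at hm
      rcases hm with hm | rfl; exact h2 π' hm; exact absurd rfl hn2
    · rw [hlen]; have := h2 π hπ; simp; omega
  · rw [hcells, cells_add_singleton]
  · rw [hpairs, pairs_add_singleton]
  · intro a b
    rw [hends, endPairs_add_singleton, Finset.mem_insert, Prod.mk.injEq]
    constructor
    · rintro (⟨h | h, h1, h2, h3, -⟩ | h | h)
      · exact absurd h.1 h3
      · exact Or.inl ⟨h, h1, h2⟩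
      · exact Or.inr (Or.inl h)
      · exact Or.inr (Or.inr h)
    · rintro (⟨h, h1, h2⟩ | h | h)
      · have ha : a ≠ by_ := fun e => hy (e ▸ mem_cells_of_mem_endPairs h)
        exact Or.inl ⟨Or.inr h, h1, h2, ha, ha⟩
      · exact Or.inr (Or.inl h)
      · exact Or.inr (Or.inr h)

/-- **Extend on the left**: the fresh vertex `x` is joined to the real end `y` of a strand of
length `≥ 2`. [cite: Jensen2004SAWLowerBounds, §2.1] -/
theorem extend_left_spec {S : List (List XCell)} (hW : WF A S) (hA : ∀ a b, A a b → A b a)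
    (h2 : ∀ π ∈ S, 2 ≤ π.length) {x y by_ : XCell}
    (hx : x ∉ cells S) (hyb : (y, by_) ∈ endPairs S) (hyr : y.IsReal) (hxy : A x y) :
      WF A (merge (S ++ [[x]]) x y) ∧ (∀ π' ∈ merge (S ++ [[x]]) x y, 2 ≤ π'.length) ∧
      cells (merge (S ++ [[x]]) x y) = insert x (cells S) ∧
      pairs (merge (S ++ [[x]]) x y) = insert s(x, y) (pairs S) ∧
      ∀ a b, (a, b) ∈ endPairs (merge (S ++ [[x]]) x y) ↔
        ((a, b) ∈ endPairs S ∧ a ≠ y ∧ a ≠ by_) ∨ (a = x ∧ b = by_) ∨ (a = by_ ∧ b = x) := by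
  obtain ⟨π, hπ, hyπ⟩ := mem_endPairs.1 hyb
  have hy : isEnd y π = true := isEnd_of_mem_epairs hyπ
  have hW₁ : WF A (S ++ [[x]]) := hW.add_singleton hx
  have hx₁ : [x] ∈ S ++ [[x]] := List.mem_append_right _ (List.mem_singleton_self _)
  have hπ₁ : π ∈ S ++ [[x]] := List.mem_append_left _ hπ
  have hne : [x] ≠ π := (ne_singleton_of_two_le (h2 π hπ) x).symm
  have hxe : isEnd x [x] = true := by simp [isEnd]
  have hyS : y ∈ cells S := mem_cells.2 ⟨π, hπ, mem_of_isEnd hy⟩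
  have hxy' : x ≠ y := fun e => hx (e ▸ hyS)
  obtain ⟨bx, by', hbx, hby, hWm, hcells, hpairs, hends⟩ :=
    merge_spec hW₁ hA hx₁ hπ₁ hne hxe hy hxy (Or.inr rfl) (Or.inl hyr)
  rw [endPairs_add_singleton, Finset.mem_insert, Prod.mk.injEq] at hbx hby
  have hby' : (y, by') ∈ endPairs S := by
    rcases hby with ⟨e, -⟩ | h; exact absurd e.symm hxy'; exact h
  have hbx' : bx = x := by
    rcases hbx with ⟨-, e⟩ | h; exact e; exact absurd (mem_cells_of_mem_endPairs h) hx
  subst hbx'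
  have hbb : by' = by_ := hW.endPairs_unique hby' hyb
  subst hbb
  refine ⟨hWm, ?_, ?_, ?_, ?_⟩
  · intro π' hπ'
    rcases hW₁.mem_merge hx₁ hπ₁ hxe hy hπ' with ⟨hm, hn1, hn2⟩ | hlen
    · rw [List.mem_append, List.mem_singleton] at hm
      rcases hm with hm | rfl; exact h2 π' hm; exact absurd rfl hn1
    · rw [hlen]; have := h2 π hπ; simp; omega
  · rw [hcells, cells_add_singleton]
  · rw [hpairs, pairs_add_singleton]
  · intro a b
    rw [hends, endPairs_add_singleton, Finset.mem_insert, Prod.mk.injEq]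
    constructor
    · rintro (⟨h | h, h1, -, h3, h4⟩ | h | h)
      · exact absurd h.1 h1
      · exact Or.inl ⟨h, h3, h4⟩
      · exact Or.inr (Or.inl h)
      · exact Or.inr (Or.inr h)
    · rintro (⟨h, h3, h4⟩ | h | h)
      · have ha : a ≠ bx := fun e => hx (e ▸ mem_cells_of_mem_endPairs h)
        exact Or.inl ⟨Or.inr h, ha, ha, h3, h4⟩
      · exact Or.inr (Or.inl h)
      · exact Or.inr (Or.inr h)

/-- **New two-vertex strand** on the fresh vertices `x ≠ y`. [cite: Jensen2004SAWLowerBounds, §2.1] -/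
theorem new2_spec {S : List (List XCell)} (hW : WF A S) (hA : ∀ a b, A a b → A b a)
    (h2 : ∀ π ∈ S, 2 ≤ π.length) {x y : XCell} (hx : x ∉ cells S) (hy : y ∉ cells S) (hxy' : x ≠ y)
    (hxy : A x y) :
    WF A (merge (S ++ [[x]] ++ [[y]]) x y) ∧ (∀ π' ∈ merge (S ++ [[x]] ++ [[y]]) x y, 2 ≤ π'.length) ∧
      cells (merge (S ++ [[x]] ++ [[y]]) x y) = insert x (insert y (cells S)) ∧
      pairs (merge (S ++ [[x]] ++ [[y]]) x y) = insert s(x, y) (pairs S) ∧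
      ∀ a b, (a, b) ∈ endPairs (merge (S ++ [[x]] ++ [[y]]) x y) ↔
        (a, b) ∈ endPairs S ∨ (a = x ∧ b = y) ∨ (a = y ∧ b = x) := by
  have hW₁ : WF A (S ++ [[x]]) := hW.add_singleton hx
  have hy₁ : y ∉ cells (S ++ [[x]]) := by
    rw [cells_add_singleton, Finset.mem_insert, not_or]; exact ⟨hxy'.symm, hy⟩
  have hW₂ : WF A (S ++ [[x]] ++ [[y]]) := hW₁.add_singleton hy₁
  have hx₂ : [x] ∈ S ++ [[x]] ++ [[y]] := List.mem_append_left _ (List.mem_append_right _ (List.mem_singleton_self _))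
  have hy₂ : [y] ∈ S ++ [[x]] ++ [[y]] := List.mem_append_right _ (List.mem_singleton_self _)
  have hne : [x] ≠ [y] := fun e => hxy' (List.singleton_inj.1 e)
  have hxe : isEnd x [x] = true := by simp [isEnd]
  have hye : isEnd y [y] = true := by simp [isEnd]
  obtain ⟨bx, by_, hbx, hby, hWm, hcells, hpairs, hends⟩ :=
    merge_spec hW₂ hA hx₂ hy₂ hne hxe hye hxy (Or.inr rfl) (Or.inr rfl)
  rw [endPairs_add_singleton, endPairs_add_singleton, Finset.mem_insert, Finset.mem_insert,
    Prod.mk.injEq, Prod.mk.injEq] at hbx hby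
  have hbx' : bx = x := by
    rcases hbx with ⟨e, -⟩ | ⟨-, e⟩ | h
    · exact absurd e hxy'
    · exact e
    · exact absurd (mem_cells_of_mem_endPairs h) hx
  have hby' : by_ = y := by
    rcases hby with ⟨-, e⟩ | ⟨e, -⟩ | h
    · exact e
    · exact absurd e.symm hxy'
    · exact absurd (mem_cells_of_mem_endPairs h) hy
  subst hbx'; subst hby'
  refine ⟨hWm, ?_, ?_, ?_, ?_⟩
  · intro π' hπ'
    rcases hW₂.mem_merge hx₂ hy₂ hxe hye hπ' with ⟨hm, hn1, hn2⟩ | hlen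
    · simp only [List.mem_append, List.mem_singleton] at hm
      rcases hm with (hm | rfl) | rfl
      · exact h2 π' hm
      · exact absurd rfl hn1
      · exact absurd rfl hn2
    · rw [hlen]; simp
  · rw [hcells, cells_add_singleton, cells_add_singleton, Finset.insert_comm]
  · rw [hpairs, pairs_add_singleton, pairs_add_singleton]
  · intro a b
    rw [hends, endPairs_add_singleton, endPairs_add_singleton, Finset.mem_insert, Finset.mem_insert,
      Prod.mk.injEq, Prod.mk.injEq]
    constructor
    · rintro (⟨h | h | h, h1, -, h3, -⟩ | h | h)
      · exact absurd h.1 h3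
      · exact absurd h.1 h1
      · exact Or.inl h
      · exact Or.inr (Or.inl h)
      · exact Or.inr (Or.inr h)
    · rintro (h | h | h)
      · have ha : a ∈ cells S := mem_cells_of_mem_endPairs h
        have hax : a ≠ bx := fun e => hx (e ▸ ha)
        have hay : a ≠ by_ := fun e => hy (e ▸ ha)
        exact Or.inl ⟨Or.inr (Or.inr h), hax, hax, hay, hay⟩
      · exact Or.inr (Or.inl h)
      · exact Or.inr (Or.inr h)

/-- End pairs are symmetric. [folklore] -/
theorem endPairs_symm {S : List (List XCell)} {a b : XCell} (h : (a, b) ∈ endPairs S) : (b, a) ∈ endPairs S := by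
  obtain ⟨π, hπ, hp⟩ := mem_endPairs.1 h
  refine mem_endPairs.2 ⟨π, hπ, ?_⟩
  rw [mem_epairs] at hp ⊢; tauto

/-- **Join** two different strands through the edge between their real ends `x` and `y`;
"different" is witnessed by the far end of `x` not being `y`. [cite: Jensen2004SAWLowerBounds, §2.1] -/
theorem join_spec {S : List (List XCell)} (hW : WF A S) (hA : ∀ a b, A a b → A b a)
    (h2 : ∀ π ∈ S, 2 ≤ π.length) {x bx y by_ : XCell} (hxb : (x, bx) ∈ endPairs S)
    (hyb : (y, by_) ∈ endPairs S) (hxy' : x ≠ y) (hfar : bx ≠ y) (hxr : x.IsReal) (hyr : y.IsReal)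
    (hxy : A x y) :
    WF A (merge S x y) ∧ (∀ π' ∈ merge S x y, 2 ≤ π'.length) ∧ cells (merge S x y) = cells S ∧
      pairs (merge S x y) = insert s(x, y) (pairs S) ∧
      ∀ a b, (a, b) ∈ endPairs (merge S x y) ↔
        ((a, b) ∈ endPairs S ∧ a ≠ x ∧ a ≠ bx ∧ a ≠ y ∧ a ≠ by_) ∨
          (a = bx ∧ b = by_) ∨ (a = by_ ∧ b = bx) := by
  obtain ⟨π₁, h₁, hx₁⟩ := mem_endPairs.1 hxb
  obtain ⟨π₂, h₂, hy₂⟩ := mem_endPairs.1 hyb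
  have hx : isEnd x π₁ = true := isEnd_of_mem_epairs hx₁
  have hy : isEnd y π₂ = true := isEnd_of_mem_epairs hy₂
  have hne : π₁ ≠ π₂ := by
    rintro rfl
    -- x and y are the two ends of π₁, so the far end of x is y
    apply hfar
    have hnd := hW.nodup π₁ h₁
    have hxy_ep : (x, y) ∈ epairs π₁ := by
      rw [mem_epairs]
      rcases isEnd_iff.1 hx with hx' | hx' <;> rcases isEnd_iff.1 hy with hy' | hy'
      · rw [hx'] at hy'; exact absurd (Option.some.inj hy') hxy'
      · exact Or.inl ⟨hx', hy'⟩
      · exact Or.inr ⟨hy', hx'⟩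
      · rw [hx'] at hy'; exact absurd (Option.some.inj hy') hxy'
    exact hW.endPairs_unique hxb (mem_endPairs.2 ⟨π₁, h₁, hxy_ep⟩)
  obtain ⟨bx', by', hbx, hby, hWm, hcells, hpairs, hends⟩ :=
    merge_spec hW hA h₁ h₂ hne hx hy hxy (Or.inl hxr) (Or.inl hyr)
  have e1 : bx' = bx := hW.endPairs_unique hbx hxb
  have e2 : by' = by_ := hW.endPairs_unique hby hyb
  subst e1; subst e2
  refine ⟨hWm, ?_, hcells, hpairs, hends⟩
  intro π' hπ'
  rcases hW.mem_merge h₁ h₂ hx hy hπ' with ⟨hm, -, -⟩ | hlen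
  · exact h2 π' hm
  · rw [hlen]; have := h2 π₁ h₁; omega


end StripTM

end Literature.Probability.RandomPlanarGeometry.SAW
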